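import Summits.KontsevichZagierPeriods.KontsevichZagierPeriods.Theses.UnfoldedStokes
import Summits.KontsevichZagierPeriods.KontsevichZagierPeriods.Theorems.UnfoldedStokesStokesGenerationStubCubifyKernel
import Summits.KontsevichZagierPeriods.KontsevichZagierPeriods.Theorems.UnfoldedStokesContinuousCubificationStubC1CADRat
import Summits.KontsevichZagierPeriods.KontsevichZagierPeriods.Theorems.UnfoldedStokesContinuousCubificationStubVolumeToCells
import Summits.KontsevichZagierPeriods.KontsevichZagierPeriods.Theorems.UnfoldedStokesContinuousCubificationStubCellFlattening
import Summits.KontsevichZagierPeriods.KontsevichZagierPeriods.Theorems.UnfoldedStokesContinuousCubificationStubDamping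
import Summits.KontsevichZagierPeriods.KontsevichZagierPeriods.Theorems.UnfoldedStokesContinuousCubificationStubMergeSum
import Literature.NumberTheory.Transcendental.KZSemiCanonicalReductionProofs
import Literature.NumberTheory.Transcendental.SemialgebraicMapsProofs
import Literature.ModelTheory.ExponentialFields.SemialgebraicC1Cells

/-!
# `ContinuousCubification` (stmt-KontsevichZagierPeriods-17853) — line `SketchIdeator1` (Korobov damping), the composition

Lead prover `prover-line-stmt-KontsevichZagierPeriods-17853-0`, 2026-08-17; line reshaped from the
crux-ideate sketch `Cruxes/ContinuousCubification/SketchIdeator1.lean` (cards `korobov-damping`,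
`lipschitz-cell-flattening`). This file closes the crux `ContinuousCubification` of route
UnfoldedStokes (piece 1/3 of the BC2 split of `StokesGeneration`) from the five landed stub files
`UnfoldedStokesContinuousCubificationStub{C1CADRat,VolumeToCells,CellFlattening,Damping,MergeSum}.lean`.

CRUX: every formal `ℤ`-combination `x` of integral representations is congruent modulo
`KZ.relations` to ONE closed-cube representation `[[0,1]^M, h]` with `h` continuous on the CLOSED
cube.

LINE. `x ≡ [[0,1]^M, h]` with `h` bounded (`stub_cubifyKernel`, LANDED) `≡ [A] − [B]` with `A, B`
bounded unit-integrand solids of dimension `M + 1` (`KZ.exists_sub_of_isBounded`, LANDED). One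
bounded unit solid `V ⊆ ℝᴺ` is cubified with CONTINUOUS integrand by:
* S1 `stub_c1CADRat` — the `ℚ`-scope `C¹` cylindrical cell decomposition adapted to `V`
  (van den Dries Ch. 7 (3.2) `(I_m)`; the tree proves the `ℝ`-scope form `exists_c1CAD` from
  `k`-scoped inputs — a port);
* S2 `stub_volumeToCells` — `[V] ≡ Σ_{open cells C ⊆ V} [C, 1]` (rule (1a): the cells partition
  `ℝᴺ`, lower-dimensional cells are null);
* S3 `stub_cellFlattening` — a bounded open `ℚ`-`C¹` cell is flattened onto the open cube by the
  iterated graph straightening `x_{i+1} = lo(x_≤i) + u_{i+1} (hi − lo)(x_≤i)`, ONE rule-(2) move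
  whose Jacobian, the product of the fibre widths, is continuous on the OPEN cube and bounded;
* S4 `stub_damping` — Korobov's cubic smoothstep self-map of the cube (rule (2), Jacobian
  `∏ 6uᵢ(1−uᵢ)` vanishing on the boundary) makes a bounded integrand continuous on the open cube
  continuous on the CLOSED cube;
* S5 `stub_mergeSum` — finitely many closed-cube representations with continuous integrands merge
  into one (rule (1b)).
All five stubs are LANDED (same namespace, imported above); this file is the composition:
`cubifyVolumeC0` (one bounded unit solid), `continuousCubification_of_hyps` (the crux statement
from the five stub statements as hypotheses, over `stub_cubifyKernel` and
`KZ.exists_sub_of_isBounded`), and `ContinuousCubification_of : ContinuousCubification`.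

References: M. Kontsevich, D. Zagier, *Periods* (2001), §1.2 (the rules); L. van den Dries, *Tame
topology and o-minimal structures* (1998), Ch. 7 (3.2) (`C¹` cell decomposition); J. Viu-Sos,
*A semi-canonical reduction for periods of Kontsevich–Zagier*, IJNT 17 (2021) (bounded volumes).
-/

noncomputable section

-- `Summit.KontsevichZagierPeriods.KontsevichZagierPeriods.…` is the tree's mandated layout (single-conjunct summit).
set_option linter.dupNamespace false

namespace Summit.KontsevichZagierPeriods.KontsevichZagierPeriods.ContinuousCubificationLine

open MeasureTheory Set
open Literature.NumberTheory.Transcendental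
open Literature.NumberTheory.Transcendental.KZ
open Literature.ModelTheory.ExponentialFields (IsSemialgebraic IsC1SACell IsCylindricalDecomposition)
open Summit.KontsevichZagierPeriods.KontsevichZagierPeriods.Theses.UnfoldedStokes (ContinuousCubification)
open Summit.KontsevichZagierPeriods.KontsevichZagierPeriods.Cruxes.StokesGeneration.FibrewiseStokes
  (stub_cubifyKernel)

/-! ## The composition (real proof over the landed reductions) -/

/-- **One bounded unit solid has a continuous closed-cube normal form** (from S1–S5): cut `V` into
its open `C¹` cells (S1, S2), flatten each cell onto the open cube (S3), damp it onto the closed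
cube (S4), and merge the closed-cube representations (S5). -/
theorem cubifyVolumeC0
    (hCAD : ∀ (m : ℕ) (𝒜 : Finset (Set (Fin m → ℝ))), (∀ A ∈ 𝒜, IsSemialgebraic ℚ A) →
      ∃ 𝒟 : Finset (Set (Fin m → ℝ)), IsCylindricalDecomposition ℚ m 𝒟 ∧
        (∀ C ∈ 𝒟, ∃ d, IsC1SACell ℚ m d C) ∧ ∀ A ∈ 𝒜, ∀ C ∈ 𝒟, C ⊆ A ∨ Disjoint C A)
    (hcells : ∀ (N : ℕ) (V : IntegralRep N), Bornology.IsBounded V.domain →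
      (∀ z ∈ V.domain, V.integrand z = 1) →
      ∀ 𝒟 : Finset (Set (Fin N → ℝ)), IsCylindricalDecomposition ℚ N 𝒟 →
        (∀ C ∈ 𝒟, ∃ d, IsC1SACell ℚ N d C) → (∀ C ∈ 𝒟, C ⊆ V.domain ∨ Disjoint C V.domain) →
        ∃ (𝒞 : Finset (Set (Fin N → ℝ))) (R : Set (Fin N → ℝ) → IntegralRep N),
          (∀ C ∈ 𝒞, (R C).domain = C ∧ IsC1SACell ℚ N N C ∧ Bornology.IsBounded C ∧
            ∀ z ∈ C, (R C).integrand z = 1) ∧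
          of V - ∑ C ∈ 𝒞, of (R C) ∈ relations)
    (hflat : ∀ (N : ℕ) (R : IntegralRep N), IsC1SACell ℚ N N R.domain → Bornology.IsBounded R.domain →
      (∀ z ∈ R.domain, R.integrand z = 1) →
      ∃ (r : IntegralRep N) (B : ℝ), r.domain = Set.pi Set.univ (fun _ : Fin N => Set.Ioo (0:ℝ) 1) ∧
        ContinuousOn r.integrand (Set.pi Set.univ (fun _ : Fin N => Set.Ioo (0:ℝ) 1)) ∧
        (∀ u ∈ Set.pi Set.univ (fun _ : Fin N => Set.Ioo (0:ℝ) 1), |r.integrand u| ≤ B) ∧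
        of R - of r ∈ relations)
    (hdamp : ∀ (M : ℕ) (r : IntegralRep M) (B : ℝ),
      r.domain = Set.pi Set.univ (fun _ : Fin M => Set.Ioo (0:ℝ) 1) →
      ContinuousOn r.integrand (Set.pi Set.univ (fun _ : Fin M => Set.Ioo (0:ℝ) 1)) →
      (∀ u ∈ Set.pi Set.univ (fun _ : Fin M => Set.Ioo (0:ℝ) 1), |r.integrand u| ≤ B) →
      ∃ t : IntegralRep M, t.domain = Set.pi Set.univ (fun _ : Fin M => Set.Icc (0:ℝ) 1) ∧
        ContinuousOn t.integrand (Set.pi Set.univ (fun _ : Fin M => Set.Icc (0:ℝ) 1)) ∧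
        of r - of t ∈ relations)
    (hmerge : ∀ (M : ℕ) (𝒞 : Finset (Set (Fin M → ℝ))) (t : Set (Fin M → ℝ) → IntegralRep M),
      (∀ C ∈ 𝒞, (t C).domain = Set.pi Set.univ (fun _ : Fin M => Set.Icc (0:ℝ) 1) ∧
        ContinuousOn (t C).integrand (Set.pi Set.univ (fun _ : Fin M => Set.Icc (0:ℝ) 1))) →
      ∃ T : IntegralRep M, T.domain = Set.pi Set.univ (fun _ : Fin M => Set.Icc (0:ℝ) 1) ∧
        ContinuousOn T.integrand (Set.pi Set.univ (fun _ : Fin M => Set.Icc (0:ℝ) 1)) ∧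
        ∑ C ∈ 𝒞, of (t C) - of T ∈ relations)
    {N : ℕ} (V : IntegralRep N) (hb : Bornology.IsBounded V.domain)
    (h1 : ∀ z ∈ V.domain, V.integrand z = 1) :
    ∃ t : IntegralRep N, t.domain = Set.pi Set.univ (fun _ : Fin N => Set.Icc (0:ℝ) 1) ∧
      ContinuousOn t.integrand (Set.pi Set.univ (fun _ : Fin N => Set.Icc (0:ℝ) 1)) ∧
      of V - of t ∈ relations := by
  classical
  obtain ⟨𝒟, h𝒟, hcell, hadapt⟩ := hCAD N {V.domain} (by
    intro A hA
    rw [Finset.mem_singleton] at hA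
    rw [hA]
    exact V.isSemialgebraic_domain)
  obtain ⟨𝒞, R, hR, hVR⟩ :=
    hcells N V hb h1 𝒟 h𝒟 hcell (hadapt _ (Finset.mem_singleton_self _))
  -- per cell: flatten, then damp
  have key : ∀ C ∈ 𝒞, ∃ t : IntegralRep N,
      t.domain = Set.pi Set.univ (fun _ : Fin N => Set.Icc (0:ℝ) 1) ∧
      ContinuousOn t.integrand (Set.pi Set.univ (fun _ : Fin N => Set.Icc (0:ℝ) 1)) ∧
      of (R C) - of t ∈ relations := by
    intro C hC
    obtain ⟨hdom, hcellC, hbC, h1C⟩ := hR C hC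
    obtain ⟨r, B, hrd, hrc, hrB, hRr⟩ := hflat N (R C) (by rw [hdom]; exact hcellC)
      (by rw [hdom]; exact hbC) (fun z hz => h1C z (by rw [← hdom]; exact hz))
    obtain ⟨t, htd, htc, hrt⟩ := hdamp N r B hrd hrc hrB
    refine ⟨t, htd, htc, ?_⟩
    have e : of (R C) - of t = (of (R C) - of r) + (of r - of t) := by abel
    rw [e]
    exact relations.add_mem hRr hrt
  have : Nonempty (IntegralRep N) := ⟨V⟩
  choose! t htd htc hRt using key
  obtain ⟨T, hTd, hTc, hsum⟩ := hmerge N 𝒞 t (fun C hC => ⟨htd C hC, htc C hC⟩)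
  refine ⟨T, hTd, hTc, ?_⟩
  have e : of V - of T = (of V - ∑ C ∈ 𝒞, of (R C)) + (∑ C ∈ 𝒞, of (R C) - ∑ C ∈ 𝒞, of (t C)) +
      (∑ C ∈ 𝒞, of (t C) - of T) := by abel
  rw [e]
  exact relations.add_mem (relations.add_mem hVR
    (sum_sub_sum_mem_relations 𝒞 _ _ fun C hC => hRt C hC)) hsum

/-- **The crux statement from the five stub statements as hypotheses** (stated in unfolded form, so
that only `ContinuousCubification_of` below concludes the route decl by name). `x ≡ [[0,1]^M, h]`
with `h` bounded (`stub_cubifyKernel`, landed) `≡ [A] − [B]` bounded unit solids of dimension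
`M + 1` (`KZ.exists_sub_of_isBounded`, landed) `≡ [t_A] − [t_B]` continuous closed-cube
representations (`cubifyVolumeC0`) `≡ [[0,1]^{M+1}, t_A − t_B]` (rule (1b)). -/
theorem continuousCubification_of_hyps
    (hCAD : ∀ (m : ℕ) (𝒜 : Finset (Set (Fin m → ℝ))), (∀ A ∈ 𝒜, IsSemialgebraic ℚ A) →
      ∃ 𝒟 : Finset (Set (Fin m → ℝ)), IsCylindricalDecomposition ℚ m 𝒟 ∧
        (∀ C ∈ 𝒟, ∃ d, IsC1SACell ℚ m d C) ∧ ∀ A ∈ 𝒜, ∀ C ∈ 𝒟, C ⊆ A ∨ Disjoint C A)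
    (hcells : ∀ (N : ℕ) (V : IntegralRep N), Bornology.IsBounded V.domain →
      (∀ z ∈ V.domain, V.integrand z = 1) →
      ∀ 𝒟 : Finset (Set (Fin N → ℝ)), IsCylindricalDecomposition ℚ N 𝒟 →
        (∀ C ∈ 𝒟, ∃ d, IsC1SACell ℚ N d C) → (∀ C ∈ 𝒟, C ⊆ V.domain ∨ Disjoint C V.domain) →
        ∃ (𝒞 : Finset (Set (Fin N → ℝ))) (R : Set (Fin N → ℝ) → IntegralRep N),
          (∀ C ∈ 𝒞, (R C).domain = C ∧ IsC1SACell ℚ N N C ∧ Bornology.IsBounded C ∧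
            ∀ z ∈ C, (R C).integrand z = 1) ∧
          of V - ∑ C ∈ 𝒞, of (R C) ∈ relations)
    (hflat : ∀ (N : ℕ) (R : IntegralRep N), IsC1SACell ℚ N N R.domain → Bornology.IsBounded R.domain →
      (∀ z ∈ R.domain, R.integrand z = 1) →
      ∃ (r : IntegralRep N) (B : ℝ), r.domain = Set.pi Set.univ (fun _ : Fin N => Set.Ioo (0:ℝ) 1) ∧
        ContinuousOn r.integrand (Set.pi Set.univ (fun _ : Fin N => Set.Ioo (0:ℝ) 1)) ∧
        (∀ u ∈ Set.pi Set.univ (fun _ : Fin N => Set.Ioo (0:ℝ) 1), |r.integrand u| ≤ B) ∧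
        of R - of r ∈ relations)
    (hdamp : ∀ (M : ℕ) (r : IntegralRep M) (B : ℝ),
      r.domain = Set.pi Set.univ (fun _ : Fin M => Set.Ioo (0:ℝ) 1) →
      ContinuousOn r.integrand (Set.pi Set.univ (fun _ : Fin M => Set.Ioo (0:ℝ) 1)) →
      (∀ u ∈ Set.pi Set.univ (fun _ : Fin M => Set.Ioo (0:ℝ) 1), |r.integrand u| ≤ B) →
      ∃ t : IntegralRep M, t.domain = Set.pi Set.univ (fun _ : Fin M => Set.Icc (0:ℝ) 1) ∧
        ContinuousOn t.integrand (Set.pi Set.univ (fun _ : Fin M => Set.Icc (0:ℝ) 1)) ∧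
        of r - of t ∈ relations)
    (hmerge : ∀ (M : ℕ) (𝒞 : Finset (Set (Fin M → ℝ))) (t : Set (Fin M → ℝ) → IntegralRep M),
      (∀ C ∈ 𝒞, (t C).domain = Set.pi Set.univ (fun _ : Fin M => Set.Icc (0:ℝ) 1) ∧
        ContinuousOn (t C).integrand (Set.pi Set.univ (fun _ : Fin M => Set.Icc (0:ℝ) 1))) →
      ∃ T : IntegralRep M, T.domain = Set.pi Set.univ (fun _ : Fin M => Set.Icc (0:ℝ) 1) ∧
        ContinuousOn T.integrand (Set.pi Set.univ (fun _ : Fin M => Set.Icc (0:ℝ) 1)) ∧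
        ∑ C ∈ 𝒞, of (t C) - of T ∈ relations) :
    ∀ x : FormalRep, ∃ (M : ℕ) (t : IntegralRep M),
      t.domain = Set.pi Set.univ (fun _ : Fin M => Set.Icc (0:ℝ) 1) ∧
      ContinuousOn t.integrand t.domain ∧ x - of t ∈ relations := by
  intro x
  obtain ⟨M, t, htd, ⟨B, hB⟩, hxt⟩ := stub_cubifyKernel x
  have hbd : Bornology.IsBounded t.domain := by
    rw [htd]; exact (isCompact_univ_pi fun _ => isCompact_Icc).isBounded
  obtain ⟨A, A', hAb, hA'b, hAi, hA'i, hrel⟩ := exists_sub_of_isBounded t hbd hB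
  obtain ⟨tA, htAd, htAc, hAt⟩ := cubifyVolumeC0 hCAD hcells hflat hdamp hmerge A hAb hAi
  obtain ⟨tB, htBd, htBc, hBt⟩ := cubifyVolumeC0 hCAD hcells hflat hdamp hmerge A' hA'b hA'i
  -- the difference of the two continuous closed-cube representations (rule (1b))
  have hsA : IsSemialgebraicFunOn ℚ (Set.pi Set.univ (fun _ : Fin (M + 1) => Set.Icc (0:ℝ) 1))
      tA.integrand := htAd ▸ tA.isSemialgebraicFunOn_integrand
  have hsB : IsSemialgebraicFunOn ℚ (Set.pi Set.univ (fun _ : Fin (M + 1) => Set.Icc (0:ℝ) 1))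
      tB.integrand := htBd ▸ tB.isSemialgebraicFunOn_integrand
  have hiA : IntegrableOn tA.integrand (Set.pi Set.univ (fun _ : Fin (M + 1) => Set.Icc (0:ℝ) 1)) :=
    htAd ▸ tA.integrableOn
  have hiB : IntegrableOn tB.integrand (Set.pi Set.univ (fun _ : Fin (M + 1) => Set.Icc (0:ℝ) 1)) :=
    htBd ▸ tB.integrableOn
  let T : IntegralRep (M + 1) :=
    { domain := Set.pi Set.univ (fun _ : Fin (M + 1) => Set.Icc (0:ℝ) 1)
      integrand := tA.integrand - tB.integrand
      isSemialgebraic_domain := htAd ▸ tA.isSemialgebraic_domain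
      isSemialgebraicFunOn_integrand := IsSemialgebraicFunOn.sub_holds hsA hsB
      integrableOn := hiA.sub hiB }
  have hT : of tA - of tB - of T ∈ relations :=
    integrandAddRel_subset_relations ⟨M + 1, tA, tB, T, by rw [htAd, htBd], by rw [htAd],
      fun z _ => by simp [T], rfl⟩
  refine ⟨M + 1, T, rfl, htAc.sub htBc, ?_⟩
  have e : x - of T = (x - of t) + (of t - (of A - of A')) + (of A - of tA) - (of A' - of tB) +
      (of tA - of tB - of T) := by abel
  rw [e]
  exact relations.add_mem (relations.sub_mem (relations.add_mem (relations.add_mem hxt hrel) hAt)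
    hBt) hT

/-- **`ContinuousCubification` holds** (crux stmt-KontsevichZagierPeriods-17853 of route
UnfoldedStokes): every formal `ℤ`-combination of Kontsevich–Zagier integral representations is
congruent modulo the moves to ONE closed-cube representation whose integrand is continuous on the
closed cube. The registered composition of line `SketchIdeator1`: the five landed stubs
`stub_c1CADRat`, `stub_volumeToCells`, `stub_cellFlattening`, `stub_damping`, `stub_mergeSum`
through `continuousCubification_of_hyps`. -/
theorem ContinuousCubification_of : ContinuousCubification :=
  continuousCubification_of_hyps stub_c1CADRat stub_volumeToCells stub_cellFlattening stub_damping
    stub_mergeSum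

end Summit.KontsevichZagierPeriods.KontsevichZagierPeriods.ContinuousCubificationLine

end
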